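import Mathlib
import HarnessLib
import Summits.AtomisticToContinuum.FouriersLaw.Theorems.CageBudgetFeketeQuasiSuperadditiveHeatVarianceStubWindowDomination

/-!
# Stub `stub_windowBudget` of line `Sketch` (idea `return-flow-bernstein`)
(crux `CageBudgetFekete.QuasiSuperadditiveHeatVariance`, item stmt-AtomisticToContinuum-15769; `--supports` file,
closes nothing)

WHAT. The registered stub A3 of the crux's skeleton
(`Cruxes/QuasiSuperadditiveHeatVariance/Lines/Sketch.lean`): for a continuous NONNEGATIVE kernel `K : ℝ → ℝ` and
`s, t ≥ 0`, the sliding-window budget is controlled by the running first moment,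
`∫₀ˢ (∫ᵤ^{u+t} K(w) dw) du ≤ ∫_{(0,s+t]} w K(w) dw` — WINDOW BUDGET (each `w ∈ (0, s+t]` is covered by the windows
`[u, u+t]`, `u ∈ [0, s]`, with multiplicity `≤ min (w, t) ≤ w`).

HOW. Fubini-free, one-variable calculus (Mathlib's interval integral and FTC). With `I v = ∫₀^v K` the primitive
(`Continuous.integral_hasStrictDerivAt`; nondecreasing because `K ≥ 0`): `∫ᵤ^{u+t} K = I (u+t) - I u`
(`window_integral_eq_primitive_sub`, imported from the sibling stub file), so the left side is
`∫ₜ^{s+t} I - ∫₀ˢ I` (`intervalIntegral.integral_comp_add_right`); by parts (FTC-2 for `v ↦ v I v - ∫₀^v I`) the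
right side is `(s+t) I (s+t) - ∫₀^{s+t} I`; splitting `∫₀^{s+t} I = ∫₀ˢ I + ∫ₛ^{s+t} I` the slack is
`[t I (s+t) - ∫ₛ^{s+t} I] + [s I (s+t) - ∫ₜ^{s+t} I] ≥ 0`, each bracket nonnegative by monotonicity of `I`.

NOT here: window domination (stub A1, the imported sibling file) and the physical negative-memory moment bound
(stub M) of the same line.
-/

noncomputable section

namespace Summit.AtomisticToContinuum.FouriersLaw.Theorems.QuasiSuperadditiveHeatVariance.ReturnFlowBernstein

open MeasureTheory Filter Set intervalIntegral
open scoped Topology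

/-- The primitive `v ↦ ∫₀^v K` of a continuous nonnegative function is monotone. [folklore] -/
theorem primitive_monotone_of_nonneg {K : ℝ → ℝ} (hK : Continuous K) (hK0 : ∀ w : ℝ, 0 ≤ K w) :
    Monotone fun v : ℝ => ∫ w in (0:ℝ)..v, K w := by
  intro a b hab
  have h : (∫ w in (0:ℝ)..a, K w) + ∫ w in a..b, K w = ∫ w in (0:ℝ)..b, K w :=
    intervalIntegral.integral_add_adjacent_intervals (hK.intervalIntegrable 0 a) (hK.intervalIntegrable a b)
  have hnn : 0 ≤ ∫ w in a..b, K w := intervalIntegral.integral_nonneg hab fun w _ => hK0 w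
  simp only
  linarith

/-- The integral of a monotone function over `[a, b]` is at most `(b - a)` times its value at the right
endpoint. [folklore] -/
theorem integral_le_sub_mul_of_monotone {f : ℝ → ℝ} (hf : Monotone f) {a b : ℝ} (hab : a ≤ b) :
    ∫ v in a..b, f v ≤ (b - a) * f b := by
  have h : ∫ v in a..b, f v ≤ ∫ _ in a..b, f b :=
    intervalIntegral.integral_mono_on hab hf.intervalIntegrable intervalIntegrable_const fun v hv => hf hv.2
  rwa [intervalIntegral.integral_const, smul_eq_mul] at h

/-- **Stub `stub_windowBudget` (registered signature, verbatim): window budget of a nonnegative kernel.**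
For a continuous kernel `K ≥ 0` and `s, t ≥ 0`:
`∫₀ˢ (∫ᵤ^{u+t} K(w) dw) du ≤ ∫_{(0,s+t]} w K(w) dw`.
Proof: with `I = ∫₀ K` (nondecreasing), the left side is `∫ₜ^{s+t} I - ∫₀ˢ I`, the right side is
`(s+t) I (s+t) - ∫₀^{s+t} I` (by parts), and the difference
`[t I (s+t) - ∫ₛ^{s+t} I] + [s I (s+t) - ∫ₜ^{s+t} I]` is nonnegative by monotonicity of `I`. [folklore] -/
theorem stub_windowBudget :
    ∀ K : ℝ → ℝ, Continuous K → (∀ w : ℝ, 0 ≤ K w) →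
    ∀ s t : ℝ, 0 ≤ s → 0 ≤ t →
      ∫ u in (0:ℝ)..s, ∫ w in u..(u + t), K w ≤ ∫ w in Set.Ioc (0:ℝ) (s + t), w * K w := by
  intro K hK hK0 s t hs ht
  -- the primitive `I` of `K` and the primitive `J` of `I`
  set I : ℝ → ℝ := fun v => ∫ w in (0:ℝ)..v, K w
  set J : ℝ → ℝ := fun v => ∫ x in (0:ℝ)..v, I x
  have hId : ∀ v : ℝ, HasDerivAt I (K v) v := fun v => (hK.integral_hasStrictDerivAt 0 v).hasDerivAt
  have hIc : Continuous I := continuous_iff_continuousAt.2 fun v => (hId v).continuousAt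
  have hIm : Monotone I := primitive_monotone_of_nonneg hK hK0
  have hJd : ∀ v : ℝ, HasDerivAt J (I v) v := fun v => (hIc.integral_hasStrictDerivAt 0 v).hasDerivAt
  have hIt : Continuous fun u : ℝ => I (u + t) := hIc.comp (continuous_add_const t)
  -- left side in closed form: `∫ₜ^{s+t} I - ∫₀ˢ I`
  have hL1 : ∫ u in (0:ℝ)..s, ∫ w in u..(u + t), K w = ∫ u in (0:ℝ)..s, (I (u + t) - I u) :=
    intervalIntegral.integral_congr fun u _ => window_integral_eq_primitive_sub hK u t
  have hL2 : ∫ u in (0:ℝ)..s, (I (u + t) - I u) = (∫ u in (0:ℝ)..s, I (u + t)) - ∫ u in (0:ℝ)..s, I u :=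
    intervalIntegral.integral_sub (hIt.intervalIntegrable _ _) (hIc.intervalIntegrable _ _)
  have hL3 : ∫ u in (0:ℝ)..s, I (u + t) = ∫ v in t..(s + t), I v := by
    rw [intervalIntegral.integral_comp_add_right I t, zero_add]
  -- right side in closed form (by parts): `(s+t) I (s+t) - ∫₀^{s+t} I`
  have hR0 : ∫ w in Set.Ioc (0:ℝ) (s + t), w * K w = ∫ w in (0:ℝ)..(s + t), w * K w :=
    (intervalIntegral.integral_of_le (add_nonneg hs ht)).symm
  have hxK : Continuous fun x : ℝ => x * K x := continuous_id.mul hK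
  have hΦd : ∀ v : ℝ, HasDerivAt (fun v : ℝ => v * I v - J v) (v * K v) v := fun v =>
    (((hasDerivAt_id' v).mul (hId v)).sub (hJd v)).congr_deriv (by ring)
  have hJ0 : J 0 = 0 := intervalIntegral.integral_same
  have hR1 : ∫ w in (0:ℝ)..(s + t), w * K w = (s + t) * I (s + t) - J (s + t) := by
    rw [intervalIntegral.integral_eq_sub_of_hasDerivAt (fun v _ => hΦd v) (hxK.intervalIntegrable _ _), hJ0]
    ring
  -- split `∫₀^{s+t} I` at `s` and bound the two tail integrals by monotonicity of `I`
  have hsplit : (∫ v in (0:ℝ)..s, I v) + ∫ v in s..(s + t), I v = J (s + t) :=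
    intervalIntegral.integral_add_adjacent_intervals (hIc.intervalIntegrable _ _) (hIc.intervalIntegrable _ _)
  have hb1 : ∫ v in s..(s + t), I v ≤ t * I (s + t) := by
    have h := integral_le_sub_mul_of_monotone hIm (show s ≤ s + t by linarith)
    rwa [add_sub_cancel_left] at h
  have hb2 : ∫ v in t..(s + t), I v ≤ s * I (s + t) := by
    have h := integral_le_sub_mul_of_monotone hIm (show t ≤ s + t by linarith)
    rwa [add_sub_cancel_right] at h
  have hst : (s + t) * I (s + t) = s * I (s + t) + t * I (s + t) := by ring
  rw [hL1, hL2, hL3, hR0, hR1]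
  linarith

end Summit.AtomisticToContinuum.FouriersLaw.Theorems.QuasiSuperadditiveHeatVariance.ReturnFlowBernstein

end
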